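/-
Copyright (c) 2026 the pub-hodgecm-mathlib formalisation cell (harness21).  Prover seat hodgecm-mathlib-K2E5-p17 (g7), Track B «K2-LIT»,
#184♮ = hLiu418 = `stmt-HodgeConjecture-24832`; #42S payer road, organ S1 (local Siegel–Weil spanning), shared row (R-b) «frame bridge tensor datum ↔ block
datum» (LEAD F0P6-plan (g14) BATCH #18 (2); road-map owner K2Liu-p07 (g3) 13:05:32Z (α) (Θ-1)…(Θ-4); assembler K2Liu-p06 (g4)).  FILE 1 of 2: the frame `Θ = Ad(PD)`.
-/
import Summits.HodgeConjecture.HodgeConjecture.Theorems.K2LiuLocalSWTensorAdaptedBlocks        -- ★ F5c-A (K2Liu-p07): `matA_tensorEmbLoc`, `gramR_tensor`, `blk_reindex_kronecker`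
import Literature.NumberTheory.GelbartRogawski1991.LocalDoubledRationalFrameSiegel           -- ★ GR: `frameConj`, `framePloc`, `transpose_pd_mul_gramD_mul_pd`, `chiDet_frameConj_pd`
import Literature.NumberTheory.K2Lit.DoubledUnitaryDegeneratePrincipalSeries                -- ★ K2Lit: `localSiegelCharacter`
import Mathlib.Data.Matrix.PEquiv
import HarnessLib

/-!
# Crux `HLiu418`, organ S1, row (R-b), FILE 1: THE PERMUTATION FRAME `Θ = Ad(P ⊕ P)` FROM THE BLOCK DATUM `(ℓ_{i₀} ⊗ V′) ⊕ (ℓ_{i₁} ⊗ V′)` TO THE TENSOR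
# DATUM `𝕍 ⊗ V′` — Gram matrices, adapted matrices, the middle flip, the Siegel unipotents and the Siegel character under the frame

Cell `hodgecm-mathlib`, crux item hLiu418 = `stmt-HodgeConjecture-24832`, route of record `HCCMUnconditional`; squad K2 ∕ K2Liu, prover K2E5-p17 (g7).
THEOREMS ONLY (no `def`, no instance, no notation, no named-fact hypothesis, no `sorry`); lane `--supports stmt-HodgeConjecture-24832 --as helper` (count-neutral).

WHY (K2Liu-p07's road map (R-b), LEAD BATCH #16∕#18).  The middle-cell value theory of the local Siegel–Weil sections (★ F6a∕F6c, K2Liu-p05) is typed on the BLOCK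
datum `T = T₁ ⊕ᶠ T₂` (`UnitaryGroup.finSum`, doubled group `U((T₁ ⊕ᶠ T₂)^𝔻)(L⁺_v)`, middle Weyl element `blkLoc (w_Δ^{T₁})`), while the socket of organ S1 and
the three witness hands (inert ∕ ramified ∕ split `hf₀off`) live on the TENSOR datum `𝕍 ⊗ V′` (★ `tensorEmbLoc : U(𝕍^𝔻) → U((𝕍 ⊗ V′)^𝔻)`, `h ↦ h ⊗ 1`, frames
`eW, e′, epsV` of ★ `DoubledTensorEmbedding`).  For `dim 𝕍 = n = 2` with lines `i₀ ≠ i₁` the two data differ by the PERMUTATION of coordinates `σ` regrouping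
`epsV (i₀, k) ↦` first block, `epsV (i₁, k) ↦` second block; `P := σ`'s permutation matrix is a RATIONAL FRAME `Pᵀ · gramR(𝕍 ⊗ V′) · P = T₁ ⊕ᶠ T₂`
(`T_k = (gramR 𝕍)_{i_k i_k} · diag dV′`), so the tree's ★ `FrameTransport.frameConj PD : U((T₁ ⊕ᶠ T₂)^𝔻)(L⁺_v) ≃ₜ* U((𝕍 ⊗ V′)^𝔻)(L⁺_v)`, `g ↦ PD g PD⁻¹`
(`PD = P ⊕ P`, ★ `LocalDoubledRationalFrameSiegel`) is the bridge `Θ⁻¹` of p07's letters (Θ-1)–(Θ-3) ((Θ-4), the section transport, is FILE 2 via ★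
`LocalSplittingCMFrameNaturality`).
* §1 (ANY `n`, ANY rational frame `P`, `PD = reindexGL e₂ (blockDiagGL (P, P))`): `matS_frameConj`, `reindex_framePloc_pd`, `framePloc_pd_inv`,
  **`adapt_matA_frameConj`** (`adapt (matA (PD h PD⁻¹)) = diag(P_v, P_v) · adapt (matA h) · diag(P_v⁻¹, P_v⁻¹)`), **`blk_matA_frameConj`** (the four blocks; Levi ↦ Levi),
  **`frameConj_nElem`** (Θ-3), **`localSiegelCharacter_frameConj`** (Θ-2; `P_Δ ↦ P_Δ` is ★ `isSiegelDelta_frameConj_pd_iff`);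
* §2 (`n = 2`, the tensor frames): `exists_blockPerm`, `blockPerm_symm_apply`, `exists_permGL`, **`transpose_perm_mul_gramR_mul_perm`** (the Gram identity),
  `perm_mul_finSumProj_mul_perm_symm` and **`frameConj_blockFlip_eq_tensorEmbLoc_flip`** (Θ-1): `PD · xB · PD⁻¹ = w₁ ⊗ 1` for any `xB` with adapted matrix
  `[[1 − E, E], [E, 1 − E]]`, `E = UnitaryGroup.finSum M₂ M₂ 1 0` (★ F6a's `blkLoc (w_Δ^{T₁})`, (R-b2-ii)) and any flip `w₁` of the line `i₀` ((R-b2-i), (R-a)).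
HONEST LABEL: HC_CM is proved only modulo the 7 printed citations (2 remaining named inputs: hLiu418 = stmt-HodgeConjecture-24832, h413 = stmt-HodgeConjecture-24833) until
rung 0 closes; count-neutral helper, closes no item.
Search: tree ★ `LocalDoubledRationalFrameSiegel` (per-place frame calculus, `isSiegelDelta_frameConj_pd_iff`, `chiDet_frameConj_pd`), ★ `LocalSplittingCMFrameNaturality` (FILE 2),
★ F5c-A; Mathlib `PEquiv.toMatrix_toPEquiv_mul`, `PEquiv.mul_toMatrix_toPEquiv`, `PEquiv.toMatrix_trans`, `Matrix.submatrix_mul_equiv`; dedup `rg "frameConj_nElem|adapt_matA_frameConj|blockPerm"` — none.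
References: [Kudla1994] S. Kudla, Israel J. Math. 87 (1994), §2–§3, Thm. 3.1; [HarrisKudlaSweet1996] J. AMS 9 (1996), §1 (1.9), (1.11), (1.15);
[MoeglinVignerasWaldspurger1987] LNM 1291, Chap. 2 II Remarque (3) (transport of structure along an isometry); [PlatonovRapinchuk1994] §2.3; [Weil1964] n° 32.
-/

set_option autoImplicit false
-- the mandated namespace repeats `HodgeConjecture.HodgeConjecture`
set_option linter.dupNamespace false

noncomputable section

open scoped Matrix Kronecker
open NumberField IsDedekindDomain Matrix
open Literature.NumberTheory.Automorphic Literature.NumberTheory.Automorphic.UnitaryGroup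
open Literature.NumberTheory.GelbartRogawski1991 Literature.NumberTheory.GelbartRogawski1991.GRConstruction
open Literature.NumberTheory.GelbartRogawski1991.UnitaryDualPair
open Literature.NumberTheory.GelbartRogawski1991.UnitaryDualPair.LocalSplitting
open Literature.NumberTheory.GelbartRogawski1991.UnitaryDualPair.LocalSplitting.FrameTransport
open Literature.NumberTheory.GelbartRogawski1991.AdaptedBlocks
open Literature.NumberTheory.K2Lit.SiegelDoubled Literature.NumberTheory.K2Lit.LocalSiegelDoubled
open Summit.HodgeConjecture.HodgeConjecture.Cruxes.HLiu418.K2LiuLocalSWSectionDefs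
open Summit.HodgeConjecture.HodgeConjecture.Cruxes.HLiu418.K2LiuLocalSWTensorAdaptedBlocks (gramR_tensor matA_tensorEmbLoc blk_reindex_kronecker reindex_kronecker_linear)

namespace Summit.HodgeConjecture.HodgeConjecture.Cruxes.HLiu418.K2LiuLocalSWTensorBlockFrame

/-! ## §1 A doubled rational frame on adapted matrices, Siegel unipotents and the Siegel character (any rank, any frame) -/

section Frame

variable (F : Type) [Field F] [NumberField F] (E : Type) [Field E] [NumberField E] [Algebra F E]
  (c : E ≃ₐ[F] E) (v : HeightOneSpectrum (𝓞 F)) (n : ℕ) {T₀ T₀' : Matrix (Fin n) (Fin n) F}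
  {JD : Matrix (Fin (n + n)) (Fin (n + n)) E} (hJD : JD = (gramD F n T₀).map (algebraMap F E))
  {JD' : Matrix (Fin (n + n)) (Fin (n + n)) E} (hJD' : JD' = (gramD F n T₀').map (algebraMap F E))
  (P : GL (Fin n) F) (hP : ((P : Matrix (Fin n) (Fin n) F))ᵀ * T₀ * (P : Matrix (Fin n) (Fin n) F) = T₀')
  {PD : GL (Fin (n + n)) F} (hPD : PD = UnitaryGroup.reindexGL (e₂ n) (UnitaryGroup.blockDiagGL (P, P)))

/-- `matS (PD h PD⁻¹) = PD · matS h · PD⁻¹` over `E ⊗ F_v` (★ `coe_frameConjLocal`, read on `localPi`). [cite: PlatonovRapinchuk1994, §2.3] -/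
theorem matS_frameConj (h : UnitaryGroup.localPi E c (n + n) JD' v) :
    matS F E c v n (frameConj F E c v (n + n) hJD hJD' PD (transpose_pd_mul_gramD_mul_pd F n P hP hPD) h) =
      (framePloc F E v (n + n) PD).1 * matS F E c v n h * ((framePloc F E v (n + n) PD)⁻¹).1 := by
  show ((UnitaryGroup.localPiEquiv E c (n + n) JD v (frameConj F E c v (n + n) hJD hJD' PD _ h)).1 : GL (Fin (n + n)) (LocalRing E v)).1 = _
  rw [localPiEquiv_frameConj, coe_frameConjLocal, Units.val_mul, Units.val_mul]

/-- the doubled frame `Q ⊕ Q` read over `E ⊗ F_v` and re-enumerated along `e₂` is `diag(Q_v, Q_v)`. [cite: HarrisKudlaSweet1996, §1 (1.9)] -/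
theorem reindex_framePloc_pd (Q : GL (Fin n) F) :
    Matrix.reindex (e₂ n).symm (e₂ n).symm (framePloc F E v (n + n) (UnitaryGroup.reindexGL (e₂ n) (UnitaryGroup.blockDiagGL (Q, Q)))).1 =
      Matrix.fromBlocks ((Q : Matrix (Fin n) (Fin n) F).map ((UnitaryGroup.toLocalRing E v).comp (algebraMap F (v.adicCompletion F)))) 0 0
        ((Q : Matrix (Fin n) (Fin n) F).map ((UnitaryGroup.toLocalRing E v).comp (algebraMap F (v.adicCompletion F)))) := by
  rw [coe_framePloc, UnitaryGroup.coe_reindexGL, UnitaryGroup.coe_blockDiagGL]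
  simp only [Matrix.reindex_apply, Equiv.symm_symm, ← Matrix.submatrix_map, Matrix.submatrix_submatrix, Equiv.symm_comp_self, Matrix.submatrix_id_id,
    Matrix.fromBlocks_map, Matrix.map_zero, map_zero]

include hPD in
/-- the inverse doubled frame is the doubled frame of `P⁻¹`. [cite: HarrisKudlaSweet1996, §1 (1.9)] -/
theorem framePloc_pd_inv : (framePloc F E v (n + n) PD)⁻¹ = framePloc F E v (n + n) (UnitaryGroup.reindexGL (e₂ n) (UnitaryGroup.blockDiagGL (P⁻¹, P⁻¹))) := by
  rw [hPD, framePloc, framePloc, ← map_inv, ← map_inv, ← map_inv, Prod.inv_mk]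

/-- **THE ADAPTED MATRIX OF `PD h PD⁻¹` IS THE `diag(P_v, P_v)`-CONJUGATE OF THAT OF `h`** (the Cayley change of basis `cayR` commutes with block scalars).
[cite: Kudla1994, §3] [cite: HarrisKudlaSweet1996, §1 (1.11)] -/
theorem adapt_matA_frameConj (h : UnitaryGroup.localPi E c (n + n) JD' v) :
    adapt (matA F E c v n (frameConj F E c v (n + n) hJD hJD' PD (transpose_pd_mul_gramD_mul_pd F n P hP hPD) h)) =
      Matrix.fromBlocks ((P : Matrix (Fin n) (Fin n) F).map ((UnitaryGroup.toLocalRing E v).comp (algebraMap F (v.adicCompletion F)))) 0 0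
          ((P : Matrix (Fin n) (Fin n) F).map ((UnitaryGroup.toLocalRing E v).comp (algebraMap F (v.adicCompletion F)))) *
        adapt (matA F E c v n h) *
        Matrix.fromBlocks (((P⁻¹ : GL (Fin n) F) : Matrix (Fin n) (Fin n) F).map ((UnitaryGroup.toLocalRing E v).comp (algebraMap F (v.adicCompletion F)))) 0 0
          (((P⁻¹ : GL (Fin n) F) : Matrix (Fin n) (Fin n) F).map ((UnitaryGroup.toLocalRing E v).comp (algebraMap F (v.adicCompletion F)))) := by
  have hmul : ∀ (A B C : Matrix (Fin (n + n)) (Fin (n + n)) (LocalRing E v)),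
      Matrix.reindex (e₂ n).symm (e₂ n).symm (A * B * C) =
        Matrix.reindex (e₂ n).symm (e₂ n).symm A * Matrix.reindex (e₂ n).symm (e₂ n).symm B * Matrix.reindex (e₂ n).symm (e₂ n).symm C := by
    intro A B C
    simp only [Matrix.reindex_apply, ← Matrix.submatrix_mul_equiv (e₂ := (e₂ n).symm.symm)]
  have hcomm : ∀ Q : Matrix (Fin n) (Fin n) (LocalRing E v), adapt (Matrix.fromBlocks Q 0 0 Q) = Matrix.fromBlocks Q 0 0 Q := by
    intro Q
    have hc : cayR (LocalRing E v) (Fin n) * Matrix.fromBlocks Q 0 0 Q = Matrix.fromBlocks Q 0 0 Q * cayR (LocalRing E v) (Fin n) := by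
      rw [cayR, Matrix.fromBlocks_multiply, Matrix.fromBlocks_multiply]
      simp
    have hc' : cayRinv (LocalRing E v) (Fin n) * Matrix.fromBlocks Q 0 0 Q = Matrix.fromBlocks Q 0 0 Q * cayRinv (LocalRing E v) (Fin n) := by
      rw [cayRinv, Matrix.smul_mul, Matrix.mul_smul, hc]
    rw [adapt, hc', Matrix.mul_assoc, cayRinv_mul_cayR, Matrix.mul_one]
  rw [matA, matS_frameConj F E c v n hJD hJD' P hP hPD, hmul, framePloc_pd_inv F E v n P hPD]
  conv_lhs => rw [hPD]
  rw [reindex_framePloc_pd F E v n P, reindex_framePloc_pd F E v n P⁻¹, ← matA, adapt_mul, adapt_mul, hcomm, hcomm]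

/-- **the four adapted blocks of `PD h PD⁻¹` are the `P_v`-conjugates of those of `h`** (so Levi-type elements `B = C = 0` go to Levi-type elements and `P_Δ` to `P_Δ`,
cf. ★ `isSiegelDelta_frameConj_pd_iff`). [cite: Kudla1994, §3] -/
theorem blk_matA_frameConj (h : UnitaryGroup.localPi E c (n + n) JD' v) :
    blkA (matA F E c v n (frameConj F E c v (n + n) hJD hJD' PD (transpose_pd_mul_gramD_mul_pd F n P hP hPD) h)) =
        (P : Matrix (Fin n) (Fin n) F).map ((UnitaryGroup.toLocalRing E v).comp (algebraMap F (v.adicCompletion F))) * blkA (matA F E c v n h) *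
          ((P⁻¹ : GL (Fin n) F) : Matrix (Fin n) (Fin n) F).map ((UnitaryGroup.toLocalRing E v).comp (algebraMap F (v.adicCompletion F))) ∧
      blkB (matA F E c v n (frameConj F E c v (n + n) hJD hJD' PD (transpose_pd_mul_gramD_mul_pd F n P hP hPD) h)) =
        (P : Matrix (Fin n) (Fin n) F).map ((UnitaryGroup.toLocalRing E v).comp (algebraMap F (v.adicCompletion F))) * blkB (matA F E c v n h) *
          ((P⁻¹ : GL (Fin n) F) : Matrix (Fin n) (Fin n) F).map ((UnitaryGroup.toLocalRing E v).comp (algebraMap F (v.adicCompletion F))) ∧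
      blkC (matA F E c v n (frameConj F E c v (n + n) hJD hJD' PD (transpose_pd_mul_gramD_mul_pd F n P hP hPD) h)) =
        (P : Matrix (Fin n) (Fin n) F).map ((UnitaryGroup.toLocalRing E v).comp (algebraMap F (v.adicCompletion F))) * blkC (matA F E c v n h) *
          ((P⁻¹ : GL (Fin n) F) : Matrix (Fin n) (Fin n) F).map ((UnitaryGroup.toLocalRing E v).comp (algebraMap F (v.adicCompletion F))) ∧
      blkD (matA F E c v n (frameConj F E c v (n + n) hJD hJD' PD (transpose_pd_mul_gramD_mul_pd F n P hP hPD) h)) =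
        (P : Matrix (Fin n) (Fin n) F).map ((UnitaryGroup.toLocalRing E v).comp (algebraMap F (v.adicCompletion F))) * blkD (matA F E c v n h) *
          ((P⁻¹ : GL (Fin n) F) : Matrix (Fin n) (Fin n) F).map ((UnitaryGroup.toLocalRing E v).comp (algebraMap F (v.adicCompletion F))) := by
  have h1 := adapt_matA_frameConj F E c v n hJD hJD' P hP hPD h
  rw [adapt_eq, adapt_eq, Matrix.fromBlocks_multiply, Matrix.fromBlocks_multiply] at h1
  simp only [Matrix.mul_zero, Matrix.zero_mul, add_zero, zero_add] at h1
  exact Matrix.fromBlocks_inj.1 h1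

/-- **(Θ-3) THE FRAME ON THE SIEGEL UNIPOTENTS**: `PD · n(t') · PD⁻¹ = n(X)` whenever `P_v t' P_v⁻¹ = X` (★ `nElem`, adapted matrix `[[1, t], [0, 1]]`).
[cite: Kudla1994, §3] [cite: Weil1964, n° 32] -/
theorem frameConj_nElem (t' : Matrix (Fin n) (Fin n) (LocalRing E v))
    (ht' : (t'.map (conjLocal E c v))ᵀ * gramS F E v n T₀' + gramS F E v n T₀' * t' = 0)
    (X : Matrix (Fin n) (Fin n) (LocalRing E v)) (hX : (X.map (conjLocal E c v))ᵀ * gramS F E v n T₀ + gramS F E v n T₀ * X = 0)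
    (hPX : (P : Matrix (Fin n) (Fin n) F).map ((UnitaryGroup.toLocalRing E v).comp (algebraMap F (v.adicCompletion F))) * t' *
      ((P⁻¹ : GL (Fin n) F) : Matrix (Fin n) (Fin n) F).map ((UnitaryGroup.toLocalRing E v).comp (algebraMap F (v.adicCompletion F))) = X) :
    frameConj F E c v (n + n) hJD hJD' PD (transpose_pd_mul_gramD_mul_pd F n P hP hPD) (nElem F E c v n hJD' t' ht') = nElem F E c v n hJD X hX := by
  have hQQ' : (P : Matrix (Fin n) (Fin n) F).map ((UnitaryGroup.toLocalRing E v).comp (algebraMap F (v.adicCompletion F))) *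
      ((P⁻¹ : GL (Fin n) F) : Matrix (Fin n) (Fin n) F).map ((UnitaryGroup.toLocalRing E v).comp (algebraMap F (v.adicCompletion F))) = 1 := by
    rw [← Matrix.map_mul, ← Units.val_mul, mul_inv_cancel, Units.val_one, Matrix.map_one _ (map_zero _) (map_one _)]
  apply matA_injective F E c v n
  apply eq_of_adapt_eq
  rw [adapt_matA_frameConj F E c v n hJD hJD' P hP hPD, adapt_matA_nElem, adapt_matA_nElem, Matrix.fromBlocks_multiply,
    Matrix.fromBlocks_multiply]
  simp only [Matrix.mul_zero, Matrix.zero_mul, add_zero, zero_add, Matrix.mul_one, hQQ', hPX]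

variable [Algebra.IsQuadraticExtension F E] {δ : E} (hcδ : c δ = -δ) (hδ : δ ≠ 0) {d : F} (hd : δ * δ = algebraMap F E d)
  (hT₀ : T₀.IsSymm) (hT₀' : T₀'.IsSymm)

omit [Algebra.IsQuadraticExtension F E] in
/-- **(Θ-2) THE SIEGEL CHARACTER IS FRAME-INVARIANT**: `χ_v(det_Δ ·) |det_Δ ·|^{s+n∕2}` takes the same value at `PD h PD⁻¹` and `h` (★ `chiDet_frameConj_pd`,
★ `norm_detDelta_frameConj_pd`; with ★ `isSiegelDelta_frameConj_pd_iff` this is the `P_Δ`-compatibility of the frame). [cite: HarrisKudlaSweet1996, §1 (1.15)] -/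
theorem localSiegelCharacter_frameConj (χv : ∀ w : PlacesOver E v, (w.1.adicCompletion E)ˣ →* ℂˣ) (s : ℂ) (h : UnitaryGroup.localPi E c (n + n) JD' v) :
    localSiegelCharacter F E c v n χv s (frameConj F E c v (n + n) hJD hJD' PD (transpose_pd_mul_gramD_mul_pd F n P hP hPD) h) =
      localSiegelCharacter F E c v n χv s h := by
  unfold localSiegelCharacter absDetDelta
  rw [chiDet_frameConj_pd F E c v n hJD hJD' P hP hPD χv h]
  congr 3
  exact Finset.prod_congr rfl fun w _ => norm_detDelta_frameConj_pd F E c v n hJD hJD' P hP hPD h w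
end Frame

/-! ## §2 The permutation frame of `𝕍 ⊗ V′` (`dim 𝕍 = 2`): Gram identity and the middle flip -/

section Tensor

variable (L : Type) [Field L] [NumberField L] [IsCMField L]
variable {N M : ℕ} (e : Fin N × Fin M ≃ Fin 2)
  (dV : Fin N → L) (hdV : ∀ i, IsCMField.complexConj L (dV i) = dV i)
  (dW : Fin M → L) (hdW : ∀ i, IsCMField.complexConj L (dW i) = dW i)
variable {M₂ M' : ℕ} (eW : Fin M × Fin M₂ ≃ Fin M') (e' : Fin N × Fin M' ≃ Fin (M₂ + M₂))
  (dV' : Fin M₂ → L) (hdV' : ∀ k, IsCMField.complexConj L (dV' k) = dV' k)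

omit [NumberField L] [IsCMField L] in
/-- **the block permutation**: for two distinct lines `i₀ ≠ i₁` of `𝕍` (`n = 2`) there is a permutation `σ` of `Fin (M₂ + M₂)` sending the coordinates
`epsV (i₀, k)` of `ℓ_{i₀} ⊗ V′` to the first block and `epsV (i₁, k)` to the second. [cite: Kudla1994, §2 (doubled space, Siegel parabolic)] -/
theorem exists_blockPerm {i₀ i₁ : Fin 2} (hi : i₀ ≠ i₁) :
    ∃ σ : Equiv.Perm (Fin (M₂ + M₂)), (∀ k, σ (epsV e eW e' (i₀, k)) = finSumFinEquiv (Sum.inl k)) ∧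
      ∀ k, σ (epsV e eW e' (i₁, k)) = finSumFinEquiv (Sum.inr k) := by
  classical
  have hcov : ∀ i : Fin 2, i ≠ i₀ → i = i₁ := by
    intro i h; have := i.isLt; have := i₀.isLt; have := i₁.isLt
    apply Fin.ext; apply Classical.by_contradiction; intro h'
    exact hi (Fin.ext (by have h1 : i.val ≠ i₀.val := fun hh => h (Fin.ext hh); omega))
  let ρ : Fin 2 × Fin M₂ ≃ Fin M₂ ⊕ Fin M₂ :=
    { toFun := fun p => if p.1 = i₀ then Sum.inl p.2 else Sum.inr p.2
      invFun := fun s => Sum.elim (fun k => (i₀, k)) (fun k => (i₁, k)) s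
      left_inv := by
        rintro ⟨i, k⟩
        by_cases h : i = i₀
        · simp [h]
        · have h' : i₁ ≠ i₀ := fun h'' => hi h''.symm
          simp [h', hcov i h]
      right_inv := by
        rintro (k | k)
        · simp
        · have h' : i₁ ≠ i₀ := fun h => hi h.symm
          simp [h'] }
  have h' : i₁ ≠ i₀ := fun h => hi h.symm
  refine ⟨(epsV e eW e').symm.trans (ρ.trans finSumFinEquiv), fun k => ?_, fun k => ?_⟩
  · simp [ρ, -finSumFinEquiv_apply_left]
  · simp [ρ, h', -finSumFinEquiv_apply_right]

omit [NumberField L] [IsCMField L] in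
/-- the inverse of the block permutation on the two blocks. [cite: Kudla1994, §2 (doubled space, Siegel parabolic)] -/
theorem blockPerm_symm_apply {i₀ i₁ : Fin 2} {σ : Equiv.Perm (Fin (M₂ + M₂))}
    (hσ₀ : ∀ k, σ (epsV e eW e' (i₀, k)) = finSumFinEquiv (Sum.inl k)) (hσ₁ : ∀ k, σ (epsV e eW e' (i₁, k)) = finSumFinEquiv (Sum.inr k)) (k : Fin M₂) :
    σ.symm (finSumFinEquiv (Sum.inl k)) = epsV e eW e' (i₀, k) ∧ σ.symm (finSumFinEquiv (Sum.inr k)) = epsV e eW e' (i₁, k) :=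
  ⟨by rw [Equiv.symm_apply_eq, hσ₀], by rw [Equiv.symm_apply_eq, hσ₁]⟩

omit [NumberField L] [IsCMField L] in
/-- a permutation matrix as an element of `GL` (inverse = the matrix of `σ⁻¹`). [folklore] -/
theorem exists_permGL (σ : Equiv.Perm (Fin (M₂ + M₂))) :
    ∃ P : GL (Fin (M₂ + M₂)) (Fp L), (P : Matrix (Fin (M₂ + M₂)) (Fin (M₂ + M₂)) (Fp L)) = σ.toPEquiv.toMatrix := by
  classical
  refine ⟨⟨σ.toPEquiv.toMatrix, σ.symm.toPEquiv.toMatrix, ?_, ?_⟩, rfl⟩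
  · rw [← PEquiv.toMatrix_trans, ← Equiv.toPEquiv_trans, Equiv.self_trans_symm, Equiv.toPEquiv_refl, PEquiv.toMatrix_refl]
  · rw [← PEquiv.toMatrix_trans, ← Equiv.toPEquiv_trans, Equiv.symm_trans_self, Equiv.toPEquiv_refl, PEquiv.toMatrix_refl]

/-- **THE PERMUTATION FRAME CARRIES THE GRAM MATRIX OF `𝕍 ⊗ V′` TO THE BLOCK DATUM**: with `gramR 𝕍 = diag(t)` (★ `exists_gramR_eq_diagonal`) and
`P = σ`'s permutation matrix, `Pᵀ · gramR(𝕍 ⊗ V′) · P = (t_{i₀} · diag dV′) ⊕ᶠ (t_{i₁} · diag dV′)`. [cite: Kudla1994, §2 (doubled space, Siegel parabolic)] -/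
theorem transpose_perm_mul_gramR_mul_perm {i₀ i₁ : Fin 2} (hi : i₀ ≠ i₁) {σ : Equiv.Perm (Fin (M₂ + M₂))}
    (hσ₀ : ∀ k, σ (epsV e eW e' (i₀, k)) = finSumFinEquiv (Sum.inl k)) (hσ₁ : ∀ k, σ (epsV e eW e' (i₁, k)) = finSumFinEquiv (Sum.inr k))
    {t : Fin 2 → Fp L} (ht : gramR L e dV hdV dW hdW = Matrix.diagonal t) :
    (σ.toPEquiv.toMatrix : Matrix (Fin (M₂ + M₂)) (Fin (M₂ + M₂)) (Fp L))ᵀ *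
        gramR L e' dV hdV (tensorFrame L dW eW dV') (tensorFrame_real L dW hdW eW dV' hdV') * σ.toPEquiv.toMatrix =
      UnitaryGroup.finSum M₂ M₂ (t i₀ • realDiagonal L dV' hdV') (t i₁ • realDiagonal L dV' hdV') := by
  classical
  rw [← PEquiv.toMatrix_symm, ← Equiv.toPEquiv_symm, PEquiv.toMatrix_toPEquiv_mul, PEquiv.mul_toMatrix_toPEquiv,
    gramR_tensor L e dV hdV dW hdW eW e' dV' hdV', ht]
  ext a b
  obtain ⟨a', rfl⟩ := finSumFinEquiv.surjective a
  obtain ⟨b', rfl⟩ := finSumFinEquiv.surjective b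
  have h0 := fun k => (blockPerm_symm_apply e eW e' hσ₀ hσ₁ k).1
  have h1 := fun k => (blockPerm_symm_apply e eW e' hσ₀ hσ₁ k).2
  rcases a' with k | k <;> rcases b' with l | l <;>
    simp only [UnitaryGroup.finSum, Matrix.reindex_apply, Matrix.submatrix_apply, id, h0, h1, Equiv.symm_apply_apply, Matrix.kroneckerMap_apply,
      Matrix.diagonal_apply_eq, Matrix.diagonal_apply_ne _ hi, Matrix.diagonal_apply_ne _ hi.symm, Matrix.fromBlocks_apply₁₁, Matrix.fromBlocks_apply₁₂,
      Matrix.fromBlocks_apply₂₁, Matrix.fromBlocks_apply₂₂, Matrix.smul_apply, smul_eq_mul, zero_mul, Matrix.zero_apply]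

variable (v : HeightOneSpectrum (𝓞 (Fp L)))

/-- **KEY**: the permutation conjugate `σ · E · σ⁻¹` of the first-block projector `E = 1 ⊕ᶠ 0` is the `epsV`-reindexed `E_{i₀i₀} ⊗ 1` (the projector on `ℓ_{i₀} ⊗ V′`).
[cite: Kudla1994, §2 (doubled space, Siegel parabolic)] -/
theorem perm_mul_finSumProj_mul_perm_symm {R : Type*} [CommRing R] {i₀ i₁ : Fin 2} (hi : i₀ ≠ i₁) {σ : Equiv.Perm (Fin (M₂ + M₂))}
    (hσ₀ : ∀ k, σ (epsV e eW e' (i₀, k)) = finSumFinEquiv (Sum.inl k)) (hσ₁ : ∀ k, σ (epsV e eW e' (i₁, k)) = finSumFinEquiv (Sum.inr k)) :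
    (σ.toPEquiv.toMatrix : Matrix _ _ R) * UnitaryGroup.finSum M₂ M₂ (1 : Matrix (Fin M₂) (Fin M₂) R) 0 * σ.symm.toPEquiv.toMatrix =
      Matrix.reindex (epsV e eW e') (epsV e eW e') (Matrix.single i₀ i₀ (1 : R) ⊗ₖ (1 : Matrix (Fin M₂) (Fin M₂) R)) := by
  classical
  have hcov : ∀ i : Fin 2, i = i₀ ∨ i = i₁ := by
    intro i; have := i.isLt; have := i₀.isLt; have := i₁.isLt
    by_cases h : i = i₀
    · exact Or.inl h
    · right; apply Fin.ext
      have h1 : i.val ≠ i₀.val := fun hh => h (Fin.ext hh)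
      have h2 : i₀.val ≠ i₁.val := fun hh => hi (Fin.ext hh)
      omega
  rw [PEquiv.toMatrix_toPEquiv_mul, PEquiv.mul_toMatrix_toPEquiv, Equiv.symm_symm]
  ext a b
  obtain ⟨⟨i, k⟩, rfl⟩ := (epsV e eW e').surjective a
  obtain ⟨⟨j, l⟩, rfl⟩ := (epsV e eW e').surjective b
  have hi' : i₁ ≠ i₀ := fun h => hi h.symm
  rcases hcov i with rfl | rfl <;> rcases hcov j with rfl | rfl <;>
    simp only [Matrix.submatrix_apply, id, hσ₀, hσ₁, UnitaryGroup.finSum, Matrix.reindex_apply, Equiv.symm_apply_apply, Matrix.fromBlocks_apply₁₁,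
      Matrix.fromBlocks_apply₁₂, Matrix.fromBlocks_apply₂₁, Matrix.fromBlocks_apply₂₂] <;>
    simp [Matrix.kroneckerMap_apply, Matrix.single, hi, Matrix.one_apply]

set_option maxHeartbeats 400000 in -- MEASURED: the `adapt_matA_frameConj` rewrite on the `(M₂+M₂)+(M₂+M₂)` group times out at 200000
/-- **(Θ-1) THE FRAME CARRIES THE BLOCK FLIP TO THE TENSOR FLIP: `PD · xB · PD⁻¹ = w₁ ⊗ 1`** for ANY element `xB` of the block datum with adapted matrix
`[[1 − E, E], [E, 1 − E]]`, `E = 1 ⊕ᶠ 0` the first-block projector (the middle Weyl element `blkLoc (w_Δ^{T₁})` of ★ F6a, whose adapted matrix is (R-b2-ii),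
K2Liu-p12) and ANY flip `w₁` of the line `i₀` of `𝕍` (adapted matrix `[[1 − E_{i₀i₀}, E_{i₀i₀}], [E_{i₀i₀}, 1 − E_{i₀i₀}]]`, (R-b2-i) ∕ the (R-a) shape); both sides
are pinned by their adapted matrices (★ `matA_injective`). [cite: Kudla1994, §3 Thm. 3.1] [cite: HarrisKudlaSweet1996, §1 (1.11)] -/
theorem frameConj_blockFlip_eq_tensorEmbLoc_flip {i₀ i₁ : Fin 2} (hi : i₀ ≠ i₁) {σ : Equiv.Perm (Fin (M₂ + M₂))}
    (hσ₀ : ∀ k, σ (epsV e eW e' (i₀, k)) = finSumFinEquiv (Sum.inl k)) (hσ₁ : ∀ k, σ (epsV e eW e' (i₁, k)) = finSumFinEquiv (Sum.inr k))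
    {T₁ T₂ : Matrix (Fin M₂) (Fin M₂) (Fp L)}
    (P : GL (Fin (M₂ + M₂)) (Fp L)) (hPσ : (P : Matrix (Fin (M₂ + M₂)) (Fin (M₂ + M₂)) (Fp L)) = σ.toPEquiv.toMatrix)
    (hP : ((P : Matrix (Fin (M₂ + M₂)) (Fin (M₂ + M₂)) (Fp L)))ᵀ *
        gramR L e' dV hdV (tensorFrame L dW eW dV') (tensorFrame_real L dW hdW eW dV' hdV') * (P : Matrix _ _ (Fp L)) =
      UnitaryGroup.finSum M₂ M₂ T₁ T₂)
    {PD : GL (Fin ((M₂ + M₂) + (M₂ + M₂))) (Fp L)} (hPD : PD = UnitaryGroup.reindexGL (e₂ (M₂ + M₂)) (UnitaryGroup.blockDiagGL (P, P)))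
    {JD' : Matrix (Fin ((M₂ + M₂) + (M₂ + M₂))) (Fin ((M₂ + M₂) + (M₂ + M₂))) L}
    (hJD' : JD' = (gramD (Fp L) (M₂ + M₂) (UnitaryGroup.finSum M₂ M₂ T₁ T₂)).map (algebraMap (Fp L) L))
    {w₁ : UnitaryGroup.localPi L (IsCMField.complexConj L) (2 + 2) (hermD L e dV hdV dW hdW) v}
    (hw₁ : adapt (matA (Fp L) L (IsCMField.complexConj L) v 2 w₁) =
      Matrix.fromBlocks (1 - Matrix.single i₀ i₀ 1) (Matrix.single i₀ i₀ 1) (Matrix.single i₀ i₀ 1) (1 - Matrix.single i₀ i₀ 1))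
    {xB : UnitaryGroup.localPi L (IsCMField.complexConj L) ((M₂ + M₂) + (M₂ + M₂)) JD' v}
    (hxB : adapt (matA (Fp L) L (IsCMField.complexConj L) v (M₂ + M₂) xB) =
      Matrix.fromBlocks (1 - UnitaryGroup.finSum M₂ M₂ 1 0) (UnitaryGroup.finSum M₂ M₂ 1 0) (UnitaryGroup.finSum M₂ M₂ 1 0) (1 - UnitaryGroup.finSum M₂ M₂ 1 0)) :
    frameConj (Fp L) L (IsCMField.complexConj L) v ((M₂ + M₂) + (M₂ + M₂))
        (hermD_eq_map_gramD L e' dV hdV (tensorFrame L dW eW dV') (tensorFrame_real L dW hdW eW dV' hdV')) hJD' PD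
        (transpose_pd_mul_gramD_mul_pd (Fp L) (M₂ + M₂) P hP hPD) xB =
      tensorEmbLoc L e dV hdV dW hdW eW e' dV' hdV' v w₁ := by
  classical
  apply matA_injective (Fp L) L (IsCMField.complexConj L) v (M₂ + M₂)
  apply eq_of_adapt_eq
  rw [adapt_matA_frameConj (Fp L) L (IsCMField.complexConj L) v (M₂ + M₂) _ hJD' P hP hPD, hxB]
  -- the tensor side: blocks of `w₁ ⊗ 1`
  obtain ⟨hA, hB, hC, hD⟩ := blk_reindex_kronecker (epsV e eW e') (matA (Fp L) L (IsCMField.complexConj L) v 2 w₁)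
    (1 : Matrix (Fin M₂) (Fin M₂) (LocalRing L v))
  have hw := hw₁; rw [adapt_eq] at hw
  obtain ⟨hwA, hwB, hwC, hwD⟩ := Matrix.fromBlocks_inj.1 hw
  rw [adapt_eq, matA_tensorEmbLoc L e dV hdV dW hdW eW e' dV' hdV' v w₁]
  rw [hA, hB, hC, hD]
  rw [hwA, hwB, hwC, hwD]
  -- the block side: conjugate the projector
  set φ := (UnitaryGroup.toLocalRing L v).comp (algebraMap (Fp L) (v.adicCompletion (Fp L))) with hφ
  have hQ : (P : Matrix (Fin (M₂ + M₂)) (Fin (M₂ + M₂)) (Fp L)).map φ = σ.toPEquiv.toMatrix := by rw [hPσ, PEquiv.map_toMatrix]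
  have hQ' : ((P⁻¹ : GL (Fin (M₂ + M₂)) (Fp L)) : Matrix (Fin (M₂ + M₂)) (Fin (M₂ + M₂)) (Fp L)).map φ = σ.symm.toPEquiv.toMatrix := by
    have h1 : ((P⁻¹ : GL (Fin (M₂ + M₂)) (Fp L)) : Matrix (Fin (M₂ + M₂)) (Fin (M₂ + M₂)) (Fp L)) = σ.symm.toPEquiv.toMatrix := by
      rw [Matrix.coe_units_inv, hPσ]
      refine Matrix.inv_eq_left_inv ?_
      rw [← PEquiv.toMatrix_trans, ← Equiv.toPEquiv_trans, Equiv.symm_trans_self, Equiv.toPEquiv_refl, PEquiv.toMatrix_refl]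
    rw [h1, PEquiv.map_toMatrix]
  have hQQ' : (σ.toPEquiv.toMatrix : Matrix _ _ (LocalRing L v)) * σ.symm.toPEquiv.toMatrix = 1 := by
    rw [← PEquiv.toMatrix_trans, ← Equiv.toPEquiv_trans, Equiv.self_trans_symm, Equiv.toPEquiv_refl, PEquiv.toMatrix_refl]
  have key := perm_mul_finSumProj_mul_perm_symm e eW e' (R := LocalRing L v) hi hσ₀ hσ₁
  have hsub := (reindex_kronecker_linear (epsV e eW e') (1 : Matrix (Fin 2) (Fin 2) (LocalRing L v)) (Matrix.single i₀ i₀ 1)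
    (1 : Matrix (Fin M₂) (Fin M₂) (LocalRing L v)) 1).2.1
  have hone : Matrix.reindex (epsV e eW e') (epsV e eW e') ((1 : Matrix (Fin 2) (Fin 2) (LocalRing L v)) ⊗ₖ (1 : Matrix (Fin M₂) (Fin M₂) (LocalRing L v))) = 1 := by
    rw [Matrix.one_kronecker_one, Matrix.reindex_apply, Matrix.submatrix_one_equiv]
  rw [hQ, hQ', Matrix.fromBlocks_multiply, Matrix.fromBlocks_multiply]
  simp only [Matrix.mul_zero, Matrix.zero_mul, add_zero, zero_add, sub_zero, Matrix.mul_sub, Matrix.sub_mul, Matrix.mul_one, hQQ', key, hsub, hone]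
end Tensor

end Summit.HodgeConjecture.HodgeConjecture.Cruxes.HLiu418.K2LiuLocalSWTensorBlockFrame

end
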